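import Literature.NumberTheory.Sieve.SmoothZetaDecayBrunTitchmarsh
import HarnessLib

/-!
# Decay of `ζ(s, y)` for `3 ≤ |t| ≤ y/(100 log y)` and every `0 < σ ≤ 1`, by counting integers

Topic `Literature/NumberTheory/Sieve`; a PROVED tool file toward `Literature.NumberTheory.Sieve.HTLocalBehaviour`
(Hildebrand–Tenenbaum 1986, Theorem 3) in the range of very small `y < 8 (log x)³`, where the saddle point
`α = α(x, y)` may be small and the Perron integral for `Ψ(x, y)` needs a bound for `|ζ(α + it, y)/ζ(α, y)|`
up to `|t|` of order `y/log y` ([HildebrandTenenbaum1986, Lemma 8 (ii)], there from Vinogradov-type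
prime sums). In that range of `t` the bound is ELEMENTARY: the primes `p ∈ (y/e³, y]` with `t log p` within
`ε' = 1/(40 log y)` of `2πℤ` lie in at most `t/2 + 2` intervals `(e^{(2πm-ε')/t}, e^{(2πm+ε')/t})`, each of
length `≤ 2.3 ε' y/t` and hence containing at most that many (plus two) INTEGERS; for `t ≤ y/(100 log y)` this
is a small fraction of the `≫ y/log y` primes of the window (Chebyshev), and each remaining prime contributes
`p^{-σ}(1 - cos(t log p)) ≥ y^{-σ}(1 - cos ε') ≫ y^{-σ}/log² y`:

* `exists_decaySum_ge_of_le_div_log` — there are `c > 0`, `y₀` with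
  `Σ_{p ≤ y} p^{-σ}(1 - cos(t log p)) ≥ c y^{1-σ}/log³ y` for `y ≥ y₀`, `0 < σ ≤ 1`, `3 ≤ |t| ≤ y/(100 log y)`.

(Companion of `SmoothZetaDecayBrunTitchmarsh.exists_decaySum_ge_linear`, which treats `3 ≤ |t| ≤ κ√y`,
`3/5 ≤ σ ≤ 1` by the Brun–Titchmarsh inequality.)

## References

* [HildebrandTenenbaum1986] A. Hildebrand, G. Tenenbaum, Trans. AMS 296 (1986) 265–290, §3 Lemma 8 (ii) and
  its proof (p. 276).
-/

noncomputable section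

open Real Finset Chebyshev

namespace Literature.NumberTheory.Sieve

/-- Sums of a non-negative function over a `Finset.biUnion` are at most the iterated sums. [folklore] -/
theorem card_biUnion_le_sum_card' {ι κ : Type*} [DecidableEq κ] (s : Finset ι) (t : ι → Finset κ) :
    ((s.biUnion t).card : ℝ) ≤ ∑ i ∈ s, ((t i).card : ℝ) := by
  have h := Finset.card_biUnion_le (s := s) (t := t)
  exact_mod_cast h

set_option maxHeartbeats 1600000 in
/-- **Core of the resonance count.** For `y ≥ y₀`, `0 < σ ≤ 1`, `t > 0` and a tolerance
`0 < ε' ≤ min(1, t/20)` such that the integer count `(t/2 + 2)(2.3 (ε'/t) y + 2)` of the resonant intervals is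
at most `y/(10 log y)`, one has `Σ_{p ≤ y} p^{-σ}(1 - cos(t log p)) ≥ 0.17 (1 - cos ε') y^{1-σ}/log y`: the primes
`y/e³ < p ≤ y` have `θ`-mass `≥ 0.27 y` (Chebyshev); the bad ones (`t log p` within `ε'` of `2πℤ`) lie in
`≤ t/2 + 2` intervals `(e^{kP-r}, e^{kP+r})`, `P = 2π/t`, `r = ε'/t`, `e^{kP} ≤ e^r y`, containing
`≤ 2.3 r y + 2` integers each, so their mass is `≤ y/10`; every good prime contributes `≥ y^{-σ}(1 - cos ε')`.
[cite: HildebrandTenenbaum1986, §3 Lemma 8 (ii)] -/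
theorem exists_mul_one_sub_cos_le_decaySum :
    ∃ y₀ : ℕ, ∀ y : ℕ, y₀ ≤ y → ∀ σ : ℝ, 0 < σ → σ ≤ 1 → ∀ t ε' : ℝ, 0 < t → 0 < ε' → ε' ≤ 1 →
      ε' ≤ t / 20 → (t / 2 + 2) * (23 / 10 * (ε' / t) * y + 2) ≤ (y : ℝ) / (10 * Real.log y) →
        17 / 100 * (1 - Real.cos ε') * ((y : ℝ) ^ (1 - σ) / Real.log y) ≤
          ∑ p ∈ Nat.primesLE y, (p : ℝ) ^ (-σ) * (1 - Real.cos (t * Real.log p)) := by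
  classical
  obtain ⟨c₁, hc₁, hθ⟩ := exists_theta_ge_linear
  -- thresholds: `log y ≥ 30`, `y ≥ 140 c₁`
  set Y : ℝ := max (Real.exp 30) (140 * c₁) with hY
  refine ⟨⌈Y⌉₊, fun y hy σ hσ0 hσ1 t ε' htpos hε'0 hε'1 hε't hcount => ?_⟩
  have hyY : Y ≤ y := le_trans (Nat.le_ceil Y) (by exact_mod_cast hy)
  have hy30 : Real.exp 30 ≤ y := le_trans (le_max_left _ _) hyY
  have hyc₁ : 140 * c₁ ≤ y := le_trans (le_max_right _ _) hyY
  have hy0 : (0 : ℝ) < y := lt_of_lt_of_le (Real.exp_pos _) hy30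
  set L : ℝ := Real.log y with hL
  have hL30 : 30 ≤ L := by
    have := Real.log_le_log (Real.exp_pos _) hy30; rwa [Real.log_exp] at this
  have hL0 : 0 < L := by linarith
  have hπ := Real.pi_gt_d2
  have hπ' := Real.pi_lt_d2
  set δ : ℝ := 1 - Real.cos ε' with hδ
  have hδlow : 2 / Real.pi ^ 2 * ε' ^ 2 ≤ δ :=
    two_div_pi_sq_mul_sq_le_one_sub_cos (φ := ε') (by rw [abs_of_nonneg hε'0.le]; linarith)
  have hδ0 : 0 < δ := lt_of_lt_of_le (by positivity) hδlow
  set P : ℝ := 2 * Real.pi / t with hP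
  set r : ℝ := ε' / t with hr
  have hP0 : 0 < P := by positivity
  have hr0 : 0 < r := by positivity
  have hr20 : r ≤ 1 / 20 := by
    rw [hr, div_le_iff₀ htpos]; linarith
  have hrt : r * t = ε' := by rw [hr]; field_simp
  -- the window of primes `y/e³ < p ≤ y`
  set a₀ : ℝ := y * Real.exp (-3) with ha₀
  have ha₀0 : 0 < a₀ := by positivity
  have ha₀y : a₀ ≤ y := by
    have : Real.exp (-3) ≤ 1 := Real.exp_le_one_iff.2 (by norm_num)
    exact mul_le_of_le_one_right hy0.le this
  set Q : Finset ℕ := Nat.primesLE y \ Nat.primesLE ⌊a₀⌋₊ with hQ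
  have hQsub : Q ⊆ Nat.primesLE y := Finset.sdiff_subset
  have hmemQ : ∀ p ∈ Q, p.Prime ∧ a₀ < p ∧ (p : ℝ) ≤ y := by
    intro p hp
    obtain ⟨hpy, hpa⟩ := Finset.mem_sdiff.1 hp
    obtain ⟨hple, hpp⟩ := Nat.mem_primesLE.1 hpy
    refine ⟨hpp, ?_, by exact_mod_cast hple⟩
    have hnot : ¬ p ≤ ⌊a₀⌋₊ := fun h => hpa (Nat.mem_primesLE.2 ⟨h, hpp⟩)
    push Not at hnot
    exact lt_of_lt_of_le (Nat.lt_floor_add_one a₀) (by exact_mod_cast hnot)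
  -- total mass `Σ_{p ∈ Q} log p = θ(y) - θ(a₀) ≥ 0.27 y`
  have hQmass : ∑ p ∈ Q, Real.log p = θ y - θ a₀ := by
    rw [hQ, theta_sub_theta_eq_sum_sdiff ha₀y, Nat.floor_natCast]
  have htotal : 27 / 100 * (y : ℝ) ≤ ∑ p ∈ Q, Real.log p := by
    rw [hQmass]
    have h1 := hθ y hy0.le
    have h2 := theta_le_log4_mul_x ha₀0.le
    have hl2 := Real.log_two_gt_d9
    have hl4 : Real.log 4 ≤ 1.3863 := by
      have h : Real.log 4 = 2 * Real.log 2 := by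
        rw [show (4 : ℝ) = 2 ^ 2 by norm_num, Real.log_pow]; push_cast; ring
      rw [h]; have := Real.log_two_lt_d9; linarith
    have he3 : Real.exp (-3) ≤ 1 / 20 := by
      rw [Real.exp_neg, inv_le_comm₀ (Real.exp_pos 3) (by norm_num)]
      linarith [exp_three_gt]
    have h3 : θ a₀ ≤ 1.3863 * (y * (1 / 20)) := by
      calc θ a₀ ≤ Real.log 4 * a₀ := h2
        _ ≤ 1.3863 * (y * (1 / 20)) := by
            rw [ha₀]
            exact mul_le_mul hl4 (mul_le_mul_of_nonneg_left he3 hy0.le) (by positivity)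
              (by norm_num)
    have h4 : 0.3465 * (y : ℝ) ≤ Real.log 2 / 2 * y :=
      mul_le_mul_of_nonneg_right (by linarith) hy0.le
    linarith
  -- good and bad primes
  set Bad : Finset ℕ := Q.filter (fun p => ∃ k : ℤ, |t * Real.log p - k * (2 * Real.pi)| < ε')
    with hBad
  set Good : Finset ℕ := Q.filter (fun p => ¬ ∃ k : ℤ, |t * Real.log p - k * (2 * Real.pi)| < ε')
    with hGood
  have hsplit : ∑ p ∈ Q, Real.log p = ∑ p ∈ Good, Real.log p + ∑ p ∈ Bad, Real.log p := by
    rw [hGood, hBad, add_comm, Finset.sum_filter_add_sum_filter_not]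
  -- ### the number of bad primes is at most `0.1 y/L`
  have hbadcard : (Bad.card : ℝ) ≤ (y : ℝ) / (10 * L) := by
    set klo : ℤ := ⌊(L - 3 - r) / P⌋ with hklo
    set khi : ℤ := ⌊(L + r) / P⌋ with hkhi
    set Kset : Finset ℤ := Finset.Icc klo khi with hKset
    set N : ℤ → ℕ := fun k => ⌊Real.exp (k * P - r)⌋₊ with hN
    set N' : ℤ → ℕ := fun k => ⌈Real.exp (k * P + r)⌉₊ with hN'
    set S : ℤ → Finset ℕ := fun k => Finset.Ioc (N k) (N' k) with hS
    -- (1) every bad prime lies in some `S k`, `k ∈ Kset`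
    have hcover : Bad ⊆ Kset.biUnion S := by
      intro p hp
      rw [hBad, Finset.mem_filter] at hp
      obtain ⟨hpQ, k, hk⟩ := hp
      obtain ⟨hpp, hpa, hpy⟩ := hmemQ p hpQ
      have hp0 : (0 : ℝ) < p := by exact_mod_cast hpp.pos
      have hdist : |Real.log p - k * P| < r := by
        have heq : t * Real.log p - k * (2 * Real.pi) = t * (Real.log p - k * P) := by
          rw [hP]; field_simp
        rw [heq, abs_mul, abs_of_pos htpos] at hk
        rw [hr, lt_div_iff₀ htpos]
        linarith
      rw [abs_lt] at hdist
      have hlow : Real.exp (k * P - r) < p := by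
        calc Real.exp (k * P - r) < Real.exp (Real.log p) := Real.exp_lt_exp.2 (by linarith)
          _ = p := Real.exp_log hp0
      have hupp : (p : ℝ) < Real.exp (k * P + r) := by
        calc (p : ℝ) = Real.exp (Real.log p) := (Real.exp_log hp0).symm
          _ < Real.exp (k * P + r) := Real.exp_lt_exp.2 (by linarith)
      have hlogp_lo : L - 3 < Real.log p := by
        have := Real.log_lt_log ha₀0 hpa
        rw [ha₀, Real.log_mul hy0.ne' (Real.exp_pos _).ne', Real.log_exp] at this
        rw [hL]; linarith
      have hlogp_hi : Real.log p ≤ L := Real.log_le_log hp0 hpy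
      rw [Finset.mem_biUnion]
      refine ⟨k, ?_, ?_⟩
      · rw [hKset, Finset.mem_Icc, hklo, hkhi]
        constructor
        · have h1 : (L - 3 - r) / P < k := by
            rw [div_lt_iff₀ hP0]; linarith
          have h2 : (⌊(L - 3 - r) / P⌋ : ℝ) ≤ (L - 3 - r) / P := Int.floor_le _
          exact_mod_cast (h2.trans_lt h1).le
        · have h1 : (k : ℝ) * P < L + r := by linarith
          have h2 : (k : ℝ) ≤ (L + r) / P := by rw [le_div_iff₀ hP0]; exact h1.le
          exact Int.le_floor.2 h2
      · rw [hS, Finset.mem_Ioc]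
        constructor
        · have : (⌊Real.exp (k * P - r)⌋₊ : ℝ) ≤ Real.exp (k * P - r) := Nat.floor_le (Real.exp_pos _).le
          exact_mod_cast (this.trans_lt hlow)
        · exact_mod_cast (hupp.le.trans (Nat.le_ceil _))
    -- (2) each `S k`, `k ∈ Kset`, has at most `2.3 r y + 2` elements
    obtain ⟨hexp_lo, hexp_hi⟩ := exp_sub_exp_neg_bounds hr0.le hr20
    have hper : ∀ k ∈ Kset, ((S k).card : ℝ) ≤ 23 / 10 * r * y + 2 := by
      intro k hk
      rw [hKset, Finset.mem_Icc, hklo, hkhi] at hk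
      set E : ℝ := Real.exp (k * P) with hE
      have hE0 : 0 < E := Real.exp_pos _
      have hkP_hi : (k : ℝ) * P ≤ L + r := by
        have h1 : (k : ℝ) ≤ (⌊(L + r) / P⌋ : ℝ) := by exact_mod_cast hk.2
        have h2 : (⌊(L + r) / P⌋ : ℝ) ≤ (L + r) / P := Int.floor_le _
        have := mul_le_mul_of_nonneg_right (h1.trans h2) hP0.le
        rwa [div_mul_cancel₀ _ hP0.ne'] at this
      have hE_hi : E ≤ Real.exp (1 / 20) * y := by
        calc E ≤ Real.exp (L + r) := Real.exp_le_exp.2 hkP_hi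
          _ ≤ Real.exp (L + 1 / 20) := Real.exp_le_exp.2 (by linarith)
          _ = Real.exp (1 / 20) * y := by rw [Real.exp_add, hL, Real.exp_log hy0]; ring
      have he20 : Real.exp (1 / 20 : ℝ) ≤ 21 / 20 + 1 / 100 := by
        have h := Real.abs_exp_sub_one_sub_id_le (x := (1 / 20 : ℝ)) (by rw [abs_of_nonneg (by norm_num)]; norm_num)
        rw [abs_le] at h
        nlinarith [h.2]
      have hE_hi' : E ≤ 107 / 100 * y := by nlinarith [hE_hi, he20, hy0]
      rw [hS, Nat.card_Ioc]
      have h1 : (⌈Real.exp (k * P + r)⌉₊ : ℝ) < Real.exp (k * P + r) + 1 := Nat.ceil_lt_add_one (Real.exp_pos _).le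
      have h2 : Real.exp (k * P - r) - 1 < ⌊Real.exp (k * P - r)⌋₊ := by
        have := Nat.lt_floor_add_one (Real.exp (k * P - r)); linarith
      have h3 : Real.exp (k * P + r) = E * Real.exp r := by rw [hE, ← Real.exp_add]
      have h4 : Real.exp (k * P - r) = E * Real.exp (-r) := by rw [hE, ← Real.exp_add]; ring_nf
      have hsub : ((N' k - N k : ℕ) : ℝ) ≤ (N' k : ℝ) - N k + 0 := by
        rcases le_or_gt (N k) (N' k) with h | h
        · rw [Nat.cast_sub h]; linarith
        · rw [Nat.sub_eq_zero_of_le h.le]; simp only [Nat.cast_zero]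
          have : (N' k : ℝ) ≥ 0 := Nat.cast_nonneg _
          -- `N k > N' k` cannot actually happen; a trivial bound suffices
          have h5 : (⌊Real.exp (k * P - r)⌋₊ : ℝ) ≤ Real.exp (k * P - r) := Nat.floor_le (Real.exp_pos _).le
          have h6 : Real.exp (k * P - r) ≤ Real.exp (k * P + r) := Real.exp_le_exp.2 (by linarith)
          have h7 : Real.exp (k * P + r) ≤ ⌈Real.exp (k * P + r)⌉₊ := Nat.le_ceil _
          simp only [hN, hN']
          linarith
      have h7 : E * Real.exp r - E * Real.exp (-r) = E * (Real.exp r - Real.exp (-r)) := by ring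
      have h8 := mul_le_mul_of_nonneg_left hexp_hi hE0.le
      have h9 : 21 / 10 * r * E ≤ 21 / 10 * r * (107 / 100 * y) := mul_le_mul_of_nonneg_left hE_hi' (by positivity)
      simp only [hN, hN'] at hsub ⊢
      nlinarith [h7, h8, h1, h2, h3, h4, hsub, h9, hr0, hy0]
    -- (3) the number of `k`
    have hcardK : (Kset.card : ℝ) ≤ t / 2 + 2 := by
      rw [hKset, Int.card_Icc]
      have h2 : (L - 3 - r) / P - 1 < ((⌊(L - 3 - r) / P⌋ : ℤ) : ℝ) := by
        have := Int.lt_floor_add_one ((L - 3 - r) / P); linarith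
      have h1 : ((⌊(L + r) / P⌋ : ℤ) : ℝ) ≤ (L + r) / P := Int.floor_le _
      have heq : (L + r) / P + 1 - ((L - 3 - r) / P - 1) = (3 + 2 * r) / P + 2 := by
        field_simp; ring
      have h3 : (3 + 2 * r) / P ≤ t / 2 := by
        rw [hP, div_div_eq_mul_div, div_le_div_iff₀ (by positivity) (by norm_num)]
        have h4 : (3 + 2 * r) * 2 ≤ 2 * Real.pi := by linarith
        have h5 := mul_le_mul_of_nonneg_left h4 htpos.le
        nlinarith [h5]
      rcases le_or_gt 0 (khi + 1 - klo) with hnn | hneg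
      · have hcast : ((khi + 1 - klo).toNat : ℝ) = (khi : ℝ) + 1 - klo := by
          have : (((khi + 1 - klo).toNat : ℤ) : ℝ) = ((khi + 1 - klo : ℤ) : ℝ) := by
            rw [Int.toNat_of_nonneg hnn]
          rw [show ((khi + 1 - klo).toNat : ℝ) = (((khi + 1 - klo).toNat : ℤ) : ℝ) by norm_cast, this]
          push_cast; ring
        rw [hcast, hkhi, hklo]
        linarith
      · rw [Int.toNat_eq_zero.2 hneg.le]
        simp only [Nat.cast_zero]
        positivity
    -- (4) assemble
    calc (Bad.card : ℝ) ≤ ((Kset.biUnion S).card : ℝ) := by exact_mod_cast Finset.card_le_card hcover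
      _ ≤ ∑ k ∈ Kset, ((S k).card : ℝ) := card_biUnion_le_sum_card' Kset S
      _ ≤ ∑ k ∈ Kset, (23 / 10 * r * y + 2) := Finset.sum_le_sum hper
      _ = Kset.card * (23 / 10 * r * y + 2) := by rw [Finset.sum_const, nsmul_eq_mul]
      _ ≤ (t / 2 + 2) * (23 / 10 * r * y + 2) := mul_le_mul_of_nonneg_right hcardK (by positivity)
      _ = (t / 2 + 2) * (23 / 10 * (ε' / t) * y + 2) := by rw [hr]
      _ ≤ (y : ℝ) / (10 * L) := hcount
  -- ### the bad mass is at most `y/10`, the good mass at least `0.17 y`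
  have hbad : ∑ p ∈ Bad, Real.log p ≤ (y : ℝ) / 10 := by
    have h1 : ∑ p ∈ Bad, Real.log p ≤ ∑ _p ∈ Bad, L := by
      refine Finset.sum_le_sum fun p hp => ?_
      have hpQ := (Finset.mem_filter.1 (by rw [hBad] at hp; exact hp)).1
      obtain ⟨hpp, -, hpy⟩ := hmemQ p hpQ
      exact Real.log_le_log (by exact_mod_cast hpp.pos) hpy
    rw [Finset.sum_const, nsmul_eq_mul] at h1
    calc ∑ p ∈ Bad, Real.log p ≤ Bad.card * L := h1
      _ ≤ y / (10 * L) * L := mul_le_mul_of_nonneg_right hbadcard hL0.le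
      _ = y / 10 := by field_simp
  have hgood_mass : 17 / 100 * (y : ℝ) ≤ ∑ p ∈ Good, Real.log p := by linarith
  -- ### the good primes
  have hterm : ∀ p ∈ Good, δ * (y : ℝ) ^ (-σ) / L * Real.log p ≤
      (p : ℝ) ^ (-σ) * (1 - Real.cos (t * Real.log p)) := by
    intro p hp
    rw [hGood, Finset.mem_filter] at hp
    obtain ⟨hpQ, hnot⟩ := hp
    obtain ⟨hpp, hpa, hpy⟩ := hmemQ p hpQ
    have hp0 : (0 : ℝ) < p := by exact_mod_cast hpp.pos
    push Not at hnot
    have hcos : Real.cos (t * Real.log p) ≤ Real.cos ε' := cos_le_cos_of_forall_dist hε'0.le hnot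
    have hone : δ ≤ 1 - Real.cos (t * Real.log p) := by rw [hδ]; linarith
    have hpow : (y : ℝ) ^ (-σ) ≤ (p : ℝ) ^ (-σ) := Real.rpow_le_rpow_of_nonpos hp0 hpy (by linarith)
    have hlogp : Real.log p ≤ L := Real.log_le_log hp0 hpy
    have hlogp0 : 0 ≤ Real.log p := Real.log_nonneg (by exact_mod_cast hpp.one_lt.le)
    have hyσ : 0 < (y : ℝ) ^ (-σ) := Real.rpow_pos_of_pos hy0 _
    calc δ * (y : ℝ) ^ (-σ) / L * Real.log p = (δ * (y : ℝ) ^ (-σ)) * (Real.log p / L) := by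
          field_simp
      _ ≤ (δ * (y : ℝ) ^ (-σ)) * 1 := by
          refine mul_le_mul_of_nonneg_left ?_ (by positivity)
          rwa [div_le_one hL0]
      _ = (y : ℝ) ^ (-σ) * δ := by ring
      _ ≤ (p : ℝ) ^ (-σ) * (1 - Real.cos (t * Real.log p)) :=
          mul_le_mul hpow hone hδ0.le (Real.rpow_nonneg hp0.le _)
  have hGoodsub : Good ⊆ Nat.primesLE y := (Finset.filter_subset _ _).trans hQsub
  have hnonneg : ∀ p ∈ Nat.primesLE y, 0 ≤ (p : ℝ) ^ (-σ) * (1 - Real.cos (t * Real.log p)) := by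
    intro p _
    have hp0 : (0 : ℝ) ≤ p := Nat.cast_nonneg _
    exact mul_nonneg (Real.rpow_nonneg hp0 _) (by linarith [Real.cos_le_one (t * Real.log p)])
  have hyσ : 0 < (y : ℝ) ^ (-σ) := Real.rpow_pos_of_pos hy0 _
  calc 17 / 100 * (1 - Real.cos ε') * ((y : ℝ) ^ (1 - σ) / Real.log y)
      = δ * (y : ℝ) ^ (-σ) / L * (17 / 100 * y) := by
        rw [show (1 : ℝ) - σ = -σ + 1 by ring, Real.rpow_add hy0, Real.rpow_one, ← hL, hδ]
        field_simp
    _ ≤ δ * (y : ℝ) ^ (-σ) / L * ∑ p ∈ Good, Real.log p :=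
        mul_le_mul_of_nonneg_left hgood_mass (by positivity)
    _ = ∑ p ∈ Good, δ * (y : ℝ) ^ (-σ) / L * Real.log p := by rw [Finset.mul_sum]
    _ ≤ ∑ p ∈ Good, (p : ℝ) ^ (-σ) * (1 - Real.cos (t * Real.log p)) := Finset.sum_le_sum hterm
    _ ≤ ∑ p ∈ Nat.primesLE y, (p : ℝ) ^ (-σ) * (1 - Real.cos (t * Real.log p)) :=
        Finset.sum_le_sum_of_subset_of_nonneg hGoodsub fun p hp _ => hnonneg p hp

set_option maxHeartbeats 800000 in
/-- **Decay of `ζ(s, y)` in the range `3 ≤ |t| ≤ y/(100 log y)`, all `0 < σ ≤ 1`**: there are `c > 0` and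
`y₀` with `Σ_{p ≤ y} p^{-σ}(1 - cos(t log p)) ≥ c · y^{1-σ}/log³ y` for `y ≥ y₀`, `0 < σ ≤ 1`,
`3 ≤ |t| ≤ y/(100 log y)` (`exists_mul_one_sub_cos_le_decaySum` with `ε' = 1/(40 log y)`: then the resonant
intervals contain `≤ 0.1 y/log y` integers, and `1 - cos ε' ≥ (2/π²) ε'²`).
[cite: HildebrandTenenbaum1986, §3 Lemma 8 (ii)] -/
theorem exists_decaySum_ge_of_le_div_log :
    ∃ c : ℝ, 0 < c ∧ ∃ y₀ : ℕ, ∀ y : ℕ, y₀ ≤ y → ∀ σ : ℝ, 0 < σ → σ ≤ 1 →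
      ∀ t : ℝ, 3 ≤ |t| → |t| ≤ (y : ℝ) / (100 * Real.log y) →
        c * ((y : ℝ) ^ (1 - σ) / Real.log y ^ 3) ≤
          ∑ p ∈ Nat.primesLE y, (p : ℝ) ^ (-σ) * (1 - Real.cos (t * Real.log p)) := by
  classical
  obtain ⟨y₁, hcore⟩ := exists_mul_one_sub_cos_le_decaySum
  obtain ⟨Y₁, -, hY₁⟩ := exists_log_le_mul_rpow (κ := 1 / 400) (ε := 1) (by norm_num) one_pos
  set Y : ℝ := max (Real.exp 30) Y₁ with hY
  refine ⟨1 / 50000, by norm_num, max y₁ ⌈Y⌉₊, fun y hy σ hσ0 hσ1 t ht3 hty => ?_⟩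
  have hy₁ : y₁ ≤ y := le_trans (le_max_left _ _) hy
  have hyY : Y ≤ y := le_trans (Nat.le_ceil Y) (by exact_mod_cast le_trans (le_max_right _ _) hy)
  have hy30 : Real.exp 30 ≤ y := le_trans (le_max_left _ _) hyY
  have hyY₁ : Y₁ ≤ y := le_trans (le_max_right _ _) hyY
  have hy0 : (0 : ℝ) < y := lt_of_lt_of_le (Real.exp_pos _) hy30
  set L : ℝ := Real.log y with hL
  have hL30 : 30 ≤ L := by
    have := Real.log_le_log (Real.exp_pos _) hy30; rwa [Real.log_exp] at this
  have hL0 : 0 < L := by linarith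
  have hLy : L ≤ 1 / 400 * y := by
    have h := hY₁ y hyY₁
    rwa [Real.rpow_one] at h
  -- reduce to `t > 0`
  wlog htpos : 0 < t generalizing t
  · have ht0 : t ≤ 0 := le_of_not_gt htpos
    have htne : t ≠ 0 := by intro h; rw [h, abs_zero] at ht3; linarith
    have h := this (-t) (by rwa [abs_neg]) (by rwa [abs_neg]) (by
      rcases lt_or_eq_of_le ht0 with h | h
      · linarith
      · exact absurd h htne)
    simpa [neg_mul, Real.cos_neg] using h
  rw [abs_of_pos htpos] at ht3 hty
  have hπ := Real.pi_gt_d2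
  have hπ' := Real.pi_lt_d2
  set ε' : ℝ := 1 / (40 * L) with hε'
  have hε'0 : 0 < ε' := by positivity
  have hε'1 : ε' ≤ 1 := by
    rw [hε', div_le_one (by positivity)]; linarith
  have hε't : ε' ≤ t / 20 := by
    rw [hε', div_le_div_iff₀ (by positivity) (by norm_num)]; nlinarith
  have hcount : (t / 2 + 2) * (23 / 10 * (ε' / t) * y + 2) ≤ (y : ℝ) / (10 * Real.log y) := by
    rw [← hL]
    have e0 : (t / 2 + 2) * (23 / 10 * (ε' / t) * y + 2) =
        23 / 20 * ε' * y + 23 / 5 * ε' * y / t + t + 4 := by field_simp; ring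
    rw [e0]
    have e1 : ε' * y = y / L * (1 / 40) := by rw [hε']; field_simp
    have e2 : 23 / 5 * ε' * y / t ≤ 23 / 5 * ε' * y / 3 :=
      div_le_div_of_nonneg_left (by positivity) (by norm_num) ht3
    have e3 : (4 : ℝ) ≤ y / L * (1 / 100) := by
      rw [show y / L * (1 / 100) = y / (100 * L) by field_simp, le_div_iff₀ (by positivity)]
      linarith
    have e4 : t ≤ y / L * (1 / 100) := by
      rw [show y / L * (1 / 100) = y / (100 * L) by field_simp]
      exact hty
    have e5 : (y : ℝ) / (10 * L) = y / L * (1 / 10) := by field_simp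
    rw [e5]
    have hyL0 : 0 ≤ (y : ℝ) / L := by positivity
    nlinarith [e1, e2, e3, e4, hyL0]
  have hmain := hcore y hy₁ σ hσ0 hσ1 t ε' htpos hε'0 hε'1 hε't hcount
  -- `c/L³ ≤ 0.17 (1 - cos ε')/L`
  have hδlow : 2 / Real.pi ^ 2 * ε' ^ 2 ≤ 1 - Real.cos ε' :=
    two_div_pi_sq_mul_sq_le_one_sub_cos (φ := ε') (by rw [abs_of_nonneg hε'0.le]; linarith)
  have hδL : 1 / 50000 * (1 / L ^ 2) ≤ 17 / 100 * (1 - Real.cos ε') := by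
    have h1 : 2 / Real.pi ^ 2 * ε' ^ 2 = 2 / (1600 * Real.pi ^ 2) * (1 / L ^ 2) := by
      rw [hε']; field_simp; ring
    have hπ2 : Real.pi ^ 2 ≤ 10 := by nlinarith
    have h2 : 1 / 50000 ≤ 17 / 100 * (2 / (1600 * Real.pi ^ 2)) := by
      rw [show 17 / 100 * (2 / (1600 * Real.pi ^ 2)) = 34 / (160000 * Real.pi ^ 2) by ring]
      rw [div_le_div_iff₀ (by norm_num) (by positivity)]
      nlinarith
    have h3 : 0 ≤ 1 / L ^ 2 := by positivity
    calc 1 / 50000 * (1 / L ^ 2) ≤ 17 / 100 * (2 / (1600 * Real.pi ^ 2)) * (1 / L ^ 2) :=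
          mul_le_mul_of_nonneg_right h2 h3
      _ = 17 / 100 * (2 / Real.pi ^ 2 * ε' ^ 2) := by rw [h1]; ring
      _ ≤ 17 / 100 * (1 - Real.cos ε') := mul_le_mul_of_nonneg_left hδlow (by norm_num)
  have hpow0 : 0 ≤ (y : ℝ) ^ (1 - σ) / Real.log y := by rw [← hL]; positivity
  calc 1 / 50000 * ((y : ℝ) ^ (1 - σ) / Real.log y ^ 3)
      = 1 / 50000 * (1 / L ^ 2) * ((y : ℝ) ^ (1 - σ) / Real.log y) := by rw [← hL]; field_simp
    _ ≤ 17 / 100 * (1 - Real.cos ε') * ((y : ℝ) ^ (1 - σ) / Real.log y) :=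
        mul_le_mul_of_nonneg_right hδL hpow0
    _ ≤ _ := hmain

set_option maxHeartbeats 800000 in
/-- **Decay of `ζ(s, y)` in the range `π/log y ≤ |t| ≤ 3`, all `0 < σ ≤ 1`**: there are `c > 0` and `y₀`
with `Σ_{p ≤ y} p^{-σ}(1 - cos(t log p)) ≥ c · y^{1-σ}/log⁵ y` for `y ≥ y₀`, `0 < σ ≤ 1`, `π/log y ≤ |t| ≤ 3`
(`exists_mul_one_sub_cos_le_decaySum` with `ε' = |t|/(100 log y)`: at most `7/2` resonant intervals with
`≤ 0.023 y/log y + 2` integers each, and `1 - cos ε' ≥ (2/π²) ε'² ≥ 2/(10⁴ log⁴ y)`).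
[cite: HildebrandTenenbaum1986, §3 Lemma 8 (ii)] -/
theorem exists_decaySum_ge_of_pi_div_log_le :
    ∃ c : ℝ, 0 < c ∧ ∃ y₀ : ℕ, ∀ y : ℕ, y₀ ≤ y → ∀ σ : ℝ, 0 < σ → σ ≤ 1 →
      ∀ t : ℝ, Real.pi / Real.log y ≤ |t| → |t| ≤ 3 →
        c * ((y : ℝ) ^ (1 - σ) / Real.log y ^ 5) ≤
          ∑ p ∈ Nat.primesLE y, (p : ℝ) ^ (-σ) * (1 - Real.cos (t * Real.log p)) := by
  classical
  obtain ⟨y₁, hcore⟩ := exists_mul_one_sub_cos_le_decaySum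
  obtain ⟨Y₁, -, hY₁⟩ := exists_log_le_mul_rpow (κ := 1 / 400) (ε := 1) (by norm_num) one_pos
  set Y : ℝ := max (Real.exp 30) Y₁ with hY
  refine ⟨1 / 40000, by norm_num, max y₁ ⌈Y⌉₊, fun y hy σ hσ0 hσ1 t htlo ht3 => ?_⟩
  have hy₁ : y₁ ≤ y := le_trans (le_max_left _ _) hy
  have hyY : Y ≤ y := le_trans (Nat.le_ceil Y) (by exact_mod_cast le_trans (le_max_right _ _) hy)
  have hy30 : Real.exp 30 ≤ y := le_trans (le_max_left _ _) hyY
  have hyY₁ : Y₁ ≤ y := le_trans (le_max_right _ _) hyY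
  have hy0 : (0 : ℝ) < y := lt_of_lt_of_le (Real.exp_pos _) hy30
  set L : ℝ := Real.log y with hL
  have hL30 : 30 ≤ L := by
    have := Real.log_le_log (Real.exp_pos _) hy30; rwa [Real.log_exp] at this
  have hL0 : 0 < L := by linarith
  have hLy : L ≤ 1 / 400 * y := by
    have h := hY₁ y hyY₁
    rwa [Real.rpow_one] at h
  have hπ := Real.pi_gt_d2
  have hπ' := Real.pi_lt_d2
  have hπL : 0 < Real.pi / L := by positivity
  -- reduce to `t > 0`
  wlog htpos : 0 < t generalizing t
  · have ht0 : t ≤ 0 := le_of_not_gt htpos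
    have htne : t ≠ 0 := by intro h; rw [h, abs_zero] at htlo; linarith
    have h := this (-t) (by rwa [abs_neg]) (by rwa [abs_neg]) (by
      rcases lt_or_eq_of_le ht0 with h | h
      · linarith
      · exact absurd h htne)
    simpa [neg_mul, Real.cos_neg] using h
  rw [abs_of_pos htpos] at htlo ht3
  set ε' : ℝ := t / (100 * L) with hε'
  have hε'0 : 0 < ε' := by positivity
  have hε'1 : ε' ≤ 1 := by
    rw [hε', div_le_one (by positivity)]; nlinarith
  have hε't : ε' ≤ t / 20 := by
    rw [hε']
    exact div_le_div_of_nonneg_left htpos.le (by norm_num) (by linarith)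
  have hcount : (t / 2 + 2) * (23 / 10 * (ε' / t) * y + 2) ≤ (y : ℝ) / (10 * Real.log y) := by
    rw [← hL]
    have e0 : ε' / t = 1 / (100 * L) := by rw [hε']; field_simp
    rw [e0]
    have e1 : 23 / 10 * (1 / (100 * L)) * y = y / L * (23 / 1000) := by field_simp; norm_num
    rw [e1]
    have e3 : (4 : ℝ) ≤ y / L * (1 / 100) := by
      rw [show y / L * (1 / 100) = y / (100 * L) by field_simp, le_div_iff₀ (by positivity)]
      linarith
    have e5 : (y : ℝ) / (10 * L) = y / L * (1 / 10) := by field_simp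
    rw [e5]
    have hyL0 : 0 ≤ (y : ℝ) / L := by positivity
    nlinarith [e3, hyL0, ht3]
  have hmain := hcore y hy₁ σ hσ0 hσ1 t ε' htpos hε'0 hε'1 hε't hcount
  -- `c/L⁵ ≤ 0.17 (1 - cos ε')/L`, as `ε' ≥ π/(100 L²)`
  have hδlow : 2 / Real.pi ^ 2 * ε' ^ 2 ≤ 1 - Real.cos ε' :=
    two_div_pi_sq_mul_sq_le_one_sub_cos (φ := ε') (by rw [abs_of_nonneg hε'0.le]; linarith)
  have hε'lo : Real.pi / (100 * L ^ 2) ≤ ε' := by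
    rw [hε', div_le_div_iff₀ (by positivity) (by positivity)]
    rw [div_le_iff₀ hL0] at htlo
    nlinarith [htlo, hL0]
  have hδL : 1 / 40000 * (1 / L ^ 4) ≤ 17 / 100 * (1 - Real.cos ε') := by
    have h1 : 2 / Real.pi ^ 2 * (Real.pi / (100 * L ^ 2)) ^ 2 = 2 / 10000 * (1 / L ^ 4) := by
      field_simp; ring
    have h2 : 2 / Real.pi ^ 2 * (Real.pi / (100 * L ^ 2)) ^ 2 ≤ 2 / Real.pi ^ 2 * ε' ^ 2 := by
      refine mul_le_mul_of_nonneg_left ?_ (by positivity)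
      exact pow_le_pow_left₀ (by positivity) hε'lo 2
    have h3 : 0 ≤ 1 / L ^ 4 := by positivity
    nlinarith [h1, h2, hδlow, h3]
  have hpow0 : 0 ≤ (y : ℝ) ^ (1 - σ) / Real.log y := by rw [← hL]; positivity
  calc 1 / 40000 * ((y : ℝ) ^ (1 - σ) / Real.log y ^ 5)
      = 1 / 40000 * (1 / L ^ 4) * ((y : ℝ) ^ (1 - σ) / Real.log y) := by rw [← hL]; field_simp
    _ ≤ 17 / 100 * (1 - Real.cos ε') * ((y : ℝ) ^ (1 - σ) / Real.log y) :=
        mul_le_mul_of_nonneg_right hδL hpow0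
    _ ≤ _ := hmain

end Literature.NumberTheory.Sieve

end
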